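import Summits.MatrixMultiplication.OmegaCensus.SmallFormats.InvertiblePointNearPruneEquivariance
import HarnessLib

/-!
# ω-census family (a): K-equivariance of the near-stage prune system — UNION CAPS and FIXED SUBSPACES (supplement to p529277)

Cell `pub-omega` (unit `pub-omega-eng1-g29`, ENG1), topic `Summits/MatrixMultiplication/OmegaCensus` (sub-folder `SmallFormats`).
Framing (verbatim): lottery ticket; floor = certified bounds/negative ranges. HONEST FRAMING: the same elementary transport-of-structure as
`InvertiblePointNearPruneEquivariance` (p529277), for a WIDER class of rank caps. In p529277 a cap reads `dim span {T a s (W s) : s ∈ ι} ≤ cap a`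
— ONE vector per unknown. The tensor engine's `(G_q)` caps (IP-LAW §3a / EQUIVARIANCE.md §1: `rank ⋃_{α ∋ q} {fp_α(W_s)}_s ≤ 8 − m_q`) are ranks of
UNIONS of several such families — several vectors per unknown —, and quotient-type prunes (`dim (span F + Q)` for a fixed subspace `Q`) carry a
fixed summand; neither is literally of the p529277 shape. Here a cap is indexed by an arbitrary type `κ a` with a term map `σ a : κ a → ι`:
`dim (Q a ⊔ span {T a j (W (σ a j)) : j ∈ κ a}) ≤ cap a` (`PruneSolU`); p529277's system is the case `κ a = ι`, `σ a = id`, `Q a = ⊥`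
(`pruneSolU_of_pruneSol_iff`). Everything transfers verbatim: transport along a linear automorphism (`PruneSolU.transport`,
`pruneSolU_iff_of_linearEquiv`, now also moving `Q a`), monotonicity, componentwise unit rescaling (`PruneSolU.smul_witness`), the matrix
instance with right multiplication by `g ∈ GL_n(k)` (`matPruneSolU_iff_image_mul_right`, `matPruneSolU_iff_restrict`), and the ω-lists of
p529277 (`omegaSolU_iff_comp_mulRight`, `omegaSolU_iff_smul_comp_mulRight`, `omegaSolU_iff_restrict`). With this file BOTH engines' printed
constraint lists ((F), doubles, (I), (A_α), (Φ) stacked, (G_q) unions; ENG1 `omega5` admissibility + footprint ranks + quotient spans by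
K-stable subspaces) are instances; the engines' SPAN TEST (`rank ⋃_s L_s < #unknowns ⇒ unsolvable`) is not a constraint but a sufficient condition
for `¬ SOL`, evaluated on the same `g`-covariant lists. Outside Lean, as before: the transcription fact (each engine enumerates exactly the solutions of its printed
list), run-time verification of the sampled `g`, node counts, time-outs. Nothing here is a bound on a rank or on `ω` the exponent.
-/

namespace Summit.MatrixMultiplication.OmegaCensus.SmallFormats

open Module Matrix

/-! ## §1 Abstract systems with union caps and fixed summands -/

section AbstractU

variable {k : Type*} [Field k] {V : Type*} [AddCommGroup V] [Module k V]
  {ι : Type*} {A : Type*} {κ : A → Type*} {U : A → Type*} [∀ a, AddCommGroup (U a)] [∀ a, Module k (U a)]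

/-- **Solvability with union caps.** `PruneSolU L σ T Q cap`: some tuple `W : ι → V` has `W s ∈ L s` for all `s`, is linearly independent, and for
every cap `a`: `dim (Q a ⊔ span {T a j (W (σ a j)) : j ∈ κ a}) ≤ cap a` (several vectors per unknown allowed; `Q a` a fixed subspace). -/
def PruneSolU (L : ι → Set V) (σ : (a : A) → κ a → ι) (T : (a : A) → κ a → (V →ₗ[k] U a))
    (Q : (a : A) → Submodule k (U a)) (cap : A → ℕ) : Prop :=
  ∃ W : ι → V, (∀ s, W s ∈ L s) ∧ LinearIndependent k W ∧
    ∀ a, finrank k ↥(Q a ⊔ Submodule.span k (Set.range fun j => T a j (W (σ a j)))) ≤ cap a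

/-- p529277's `PruneSol` is the special case `κ a = ι`, `σ a = id`, `Q a = ⊥`. -/
theorem pruneSolU_of_pruneSol_iff (L : ι → Set V) (T : (a : A) → ι → (V →ₗ[k] U a)) (cap : A → ℕ) :
    PruneSol L T cap ↔ PruneSolU L (fun _ => id) T (fun _ => ⊥) cap := by
  unfold PruneSol PruneSolU
  refine exists_congr fun W => and_congr_right fun _ => and_congr_right fun _ => forall_congr' fun a => ?_
  show _ ↔ finrank k ↥(⊥ ⊔ Submodule.span k (Set.range fun j => T a j (W j))) ≤ cap a
  rw [bot_sup_eq]

/-- Moving a fixed summand and a family by one linear automorphism of the target does not change `dim (Q ⊔ span family)`. -/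
theorem finrank_sup_span_range_comp_equiv {W' : Type*} [AddCommGroup W'] [Module k W'] {κ' : Type*} (e : W' ≃ₗ[k] W')
    (Q : Submodule k W') (v : κ' → W') :
    finrank k ↥(Q.map (e : W' →ₗ[k] W') ⊔ Submodule.span k (Set.range fun j => e (v j))) =
      finrank k ↥(Q ⊔ Submodule.span k (Set.range v)) := by
  have hr : (Set.range fun j => e (v j)) = e '' Set.range v := by
    ext x; simp [Set.mem_range, Set.mem_image]
  rw [hr, ← LinearEquiv.coe_coe, ← Submodule.map_span, ← Submodule.map_sup, LinearEquiv.finrank_map_eq]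

/-- **Transport of witnesses** (`L' s = e '' L s`, `T' a j (e v) = e_a (T a j v)`, `Q' a = e_a (Q a)`). -/
theorem PruneSolU.transport (e : V ≃ₗ[k] V) (eU : ∀ a, U a ≃ₗ[k] U a)
    {L L' : ι → Set V} (hL : ∀ s, L' s = e '' L s) (σ : (a : A) → κ a → ι)
    {T T' : (a : A) → κ a → (V →ₗ[k] U a)} (hT : ∀ a j v, T' a j (e v) = eU a (T a j v))
    {Q Q' : (a : A) → Submodule k (U a)} (hQ : ∀ a, Q' a = (Q a).map (eU a : U a →ₗ[k] U a)) {cap : A → ℕ}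
    (h : PruneSolU L σ T Q cap) : PruneSolU L' σ T' Q' cap := by
  obtain ⟨W, hWL, hWind, hWcap⟩ := h
  refine ⟨fun s => e (W s), ?_, ?_, ?_⟩
  · intro s
    rw [hL s]; exact ⟨W s, hWL s, rfl⟩
  · exact hWind.map' (e : V →ₗ[k] V) e.ker
  · intro a
    have hfam : (fun j => T' a j (e (W (σ a j)))) = fun j => eU a (T a j (W (σ a j))) := by
      funext j; exact hT a j (W (σ a j))
    rw [hfam, hQ a, finrank_sup_span_range_comp_equiv (eU a) (Q a) (fun j => T a j (W (σ a j)))]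
    exact hWcap a

/-- **Solvability with union caps is invariant under transport.** -/
theorem pruneSolU_iff_of_linearEquiv (e : V ≃ₗ[k] V) (eU : ∀ a, U a ≃ₗ[k] U a)
    {L L' : ι → Set V} (hL : ∀ s, L' s = e '' L s) (σ : (a : A) → κ a → ι)
    {T T' : (a : A) → κ a → (V →ₗ[k] U a)} (hT : ∀ a j v, T' a j (e v) = eU a (T a j v))
    {Q Q' : (a : A) → Submodule k (U a)} (hQ : ∀ a, Q' a = (Q a).map (eU a : U a →ₗ[k] U a)) (cap : A → ℕ) :
    PruneSolU L σ T Q cap ↔ PruneSolU L' σ T' Q' cap := by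
  constructor
  · exact PruneSolU.transport e eU hL σ hT hQ
  · refine PruneSolU.transport e.symm (fun a => (eU a).symm) ?_ σ ?_ ?_
    · intro s
      rw [hL s, ← Set.image_comp]
      ext x; simp
    · intro a j v
      have h := hT a j (e.symm v)
      rw [LinearEquiv.apply_symm_apply] at h
      rw [h, LinearEquiv.symm_apply_apply]
    · intro a
      rw [hQ a, ← Submodule.map_comp]
      ext x; simp

/-- Shrinking candidate sets can only destroy witnesses. -/
theorem PruneSolU.mono {L L' : ι → Set V} (hLL : ∀ s, L' s ⊆ L s) {σ : (a : A) → κ a → ι}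
    {T : (a : A) → κ a → (V →ₗ[k] U a)} {Q : (a : A) → Submodule k (U a)} {cap : A → ℕ}
    (h : PruneSolU L' σ T Q cap) : PruneSolU L σ T Q cap := by
  obtain ⟨W, hWL, hWind, hWcap⟩ := h
  exact ⟨W, fun s => hLL s (hWL s), hWind, hWcap⟩

/-- **Componentwise rescaling by units keeps a witness** (cone-shaped candidate sets): every vector of every cap family is rescaled by a unit. -/
theorem PruneSolU.smul_witness {L : ι → Set V} (hcone : ∀ s (c : k), c ≠ 0 → ∀ v ∈ L s, c • v ∈ L s)
    (σ : (a : A) → κ a → ι) {T : (a : A) → κ a → (V →ₗ[k] U a)} {Q : (a : A) → Submodule k (U a)} {cap : A → ℕ} {W : ι → V}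
    (hWL : ∀ s, W s ∈ L s) (hWind : LinearIndependent k W)
    (hWcap : ∀ a, finrank k ↥(Q a ⊔ Submodule.span k (Set.range fun j => T a j (W (σ a j)))) ≤ cap a)
    (c : ι → k) (hc : ∀ s, c s ≠ 0) :
    (∀ s, c s • W s ∈ L s) ∧ LinearIndependent k (fun s => c s • W s) ∧
      ∀ a, finrank k ↥(Q a ⊔ Submodule.span k (Set.range fun j => T a j (c (σ a j) • W (σ a j)))) ≤ cap a := by
  refine ⟨fun s => hcone s (c s) (hc s) (W s) (hWL s), hWind.units_smul fun s => Units.mk0 (c s) (hc s), ?_⟩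
  intro a
  have hfam : (fun j => T a j (c (σ a j) • W (σ a j))) = fun j => c (σ a j) • T a j (W (σ a j)) := by
    funext j; rw [LinearMap.map_smul]
  rw [hfam, span_range_smul_eq_of_ne_zero (fun j => c (σ a j)) (fun j => hc (σ a j))]
  exact hWcap a

end AbstractU

/-! ## §2 The matrix instance with union caps -/

section MatrixInstanceU

variable {k : Type*} [Field k] {m n : ℕ}

/-- **Matrix systems with union caps.** Candidate sets `L s`, caps `a` indexed by `κ a` with term map `σ a`, stacked left matrices
`M a j : Fin (p a) → k^{m×m}`, fixed summands `Q a ⊆ (k^{m×n})^{p a}`. -/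
def MatPruneSolU {ι A : Type*} {κ : A → Type*} (L : ι → Set (Matrix (Fin m) (Fin n) k)) (p : A → ℕ) (σ : (a : A) → κ a → ι)
    (M : (a : A) → κ a → Fin (p a) → Matrix (Fin m) (Fin m) k) (Q : (a : A) → Submodule k (Fin (p a) → Matrix (Fin m) (Fin n) k))
    (cap : A → ℕ) : Prop :=
  PruneSolU L σ (U := fun a => Fin (p a) → Matrix (Fin m) (Fin n) k) (fun a j => stackLeftMul (M a j)) Q cap

/-- **Right translation by an invertible `g` preserves solvability** (candidate sets AND fixed summands translated; caps, left matrices,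
term maps unchanged). -/
theorem matPruneSolU_iff_image_mul_right {ι A : Type*} {κ : A → Type*} (L : ι → Set (Matrix (Fin m) (Fin n) k)) (p : A → ℕ)
    (σ : (a : A) → κ a → ι) (M : (a : A) → κ a → Fin (p a) → Matrix (Fin m) (Fin m) k)
    (Q : (a : A) → Submodule k (Fin (p a) → Matrix (Fin m) (Fin n) k)) (cap : A → ℕ)
    (g : Matrix (Fin n) (Fin n) k) (hg : IsUnit g.det) :
    MatPruneSolU L p σ M Q cap ↔
      MatPruneSolU (fun s => (fun W : Matrix (Fin m) (Fin n) k => W * g) '' L s) p σ M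
        (fun a => (Q a).map (stackMulRight (m := m) (p a) g hg).toLinearMap) cap := by
  unfold MatPruneSolU
  exact pruneSolU_iff_of_linearEquiv (matMulRight g hg) (fun a => stackMulRight (p a) g hg) (fun s => rfl) σ
    (fun a j v => stackLeftMul_mul_right (M a j) g hg v) (fun a => rfl) cap

/-- **In-branch orbit representatives with union caps** (as `matPruneSol_iff_restrict`; the fixed summands must be `g`-stable). -/
theorem matPruneSolU_iff_restrict {ι A : Type*} {κ : A → Type*} [DecidableEq ι] (L : ι → Set (Matrix (Fin m) (Fin n) k)) (p : A → ℕ)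
    (σ : (a : A) → κ a → ι) (M : (a : A) → κ a → Fin (p a) → Matrix (Fin m) (Fin m) k)
    (Q : (a : A) → Submodule k (Fin (p a) → Matrix (Fin m) (Fin n) k)) (cap : A → ℕ)
    (hcone : ∀ s (c : k), c ≠ 0 → ∀ v ∈ L s, c • v ∈ L s)
    (G : Set (Matrix (Fin n) (Fin n) k)) (hGdet : ∀ g ∈ G, IsUnit g.det)
    (hGL : ∀ g ∈ G, ∀ s, (fun W : Matrix (Fin m) (Fin n) k => W * g) '' L s = L s)
    (hGQ : ∀ g (hgG : g ∈ G) a, (Q a).map (stackMulRight (m := m) (p a) g (hGdet g hgG)).toLinearMap = Q a)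
    (s₁ : ι) (R : Set (Matrix (Fin m) (Fin n) k))
    (hR : ∀ v ∈ L s₁, ∃ g ∈ G, ∃ c : k, c ≠ 0 ∧ c • (v * g) ∈ R) :
    MatPruneSolU L p σ M Q cap ↔ MatPruneSolU (Function.update L s₁ (L s₁ ∩ R)) p σ M Q cap := by
  constructor
  · rintro ⟨W, hWL, hWind, hWcap⟩
    obtain ⟨g, hgG, c, hc, hcR⟩ := hR (W s₁) (hWL s₁)
    have hg := hGdet g hgG
    have hT := PruneSolU.transport (matMulRight g hg) (fun a => stackMulRight (p a) g hg) (L := L) (fun s => rfl) σ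
      (T := fun a j => stackLeftMul (M a j)) (fun a j v => stackLeftMul_mul_right (M a j) g hg v) (Q := Q) (fun a => rfl)
      ⟨W, hWL, hWind, hWcap⟩
    -- the transported system is the original one (lists and summands are `g`-stable); its witness is `s ↦ W s * g`
    obtain ⟨h1L, h1ind, h1cap⟩ : (∀ s, W s * g ∈ L s) ∧ LinearIndependent k (fun s => W s * g) ∧
        ∀ a, finrank k ↥(Q a ⊔ Submodule.span k (Set.range fun j => stackLeftMul (n := n) (M a j) (W (σ a j) * g))) ≤ cap a := by
      refine ⟨fun s => ?_, (linearIndependent_mul_right_iff g hg W).2 hWind, fun a => ?_⟩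
      · rw [← hGL g hgG s]; exact ⟨W s, hWL s, rfl⟩
      · have hfam : (fun j => stackLeftMul (n := n) (M a j) (W (σ a j) * g)) =
            fun j => stackMulRight (p a) g hg (stackLeftMul (n := n) (M a j) (W (σ a j))) := by
          funext j; exact stackLeftMul_mul_right (M a j) g hg (W (σ a j))
        rw [hfam, ← hGQ g hgG a, finrank_sup_span_range_comp_equiv (stackMulRight (p a) g hg)]
        exact hWcap a
    let d : ι → k := fun s => if s = s₁ then c else 1
    have hd : ∀ s, d s ≠ 0 := fun s => by by_cases h : s = s₁ <;> simp [d, h, hc]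
    obtain ⟨h2L, h2ind, h2cap⟩ := PruneSolU.smul_witness (T := fun a j => stackLeftMul (n := n) (M a j)) hcone σ h1L h1ind
      h1cap d hd
    refine ⟨fun s => d s • (W s * g), ?_, h2ind, h2cap⟩
    intro s
    by_cases h : s = s₁
    · subst h
      rw [Function.update_self]
      refine ⟨h2L s, ?_⟩
      simpa only [d, if_true] using hcR
    · rw [Function.update_of_ne h]; exact h2L s
  · intro h
    refine PruneSolU.mono ?_ h
    intro s
    by_cases hs : s = s₁
    · subst hs; rw [Function.update_self]; exact Set.inter_subset_left
    · rw [Function.update_of_ne hs]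

end MatrixInstanceU

/-! ## §3 The ω-branch system with union caps -/

section OmegaListsU

variable {k : Type*} [Field k] {m n : ℕ}

/-- **The ω-branch system with union caps and fixed summands.** -/
def OmegaSolU {ι A : Type*} {κ : A → Type*} (P : Submodule k (Matrix (Fin m) (Fin n) k))
    (f : ι → Module.Dual k (Matrix (Fin m) (Fin m) k)) (Φ : ι → (Matrix (Fin m) (Fin m) k → k) → Prop) (p : A → ℕ)
    (σ : (a : A) → κ a → ι) (M : (a : A) → κ a → Fin (p a) → Matrix (Fin m) (Fin m) k)
    (Q : (a : A) → Submodule k (Fin (p a) → Matrix (Fin m) (Fin n) k)) (cap : A → ℕ)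
    (ω : Module.Dual k (Matrix (Fin m) (Fin n) k)) : Prop :=
  MatPruneSolU (fun s => omegaList P (f s) (Φ s) ω) p σ M Q cap

/-- **THE K-EQUIVARIANCE THEOREM with union caps.** For invertible `g` with `P·g ⊆ P`, `P·g⁻¹ ⊆ P` and `g`-stable fixed summands:
`SOL(ω) ⇔ SOL(ω ∘ (· g))`. -/
theorem omegaSolU_iff_comp_mulRight {ι A : Type*} {κ : A → Type*} (P : Submodule k (Matrix (Fin m) (Fin n) k))
    (f : ι → Module.Dual k (Matrix (Fin m) (Fin m) k)) (Φ : ι → (Matrix (Fin m) (Fin m) k → k) → Prop) (p : A → ℕ)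
    (σ : (a : A) → κ a → ι) (M : (a : A) → κ a → Fin (p a) → Matrix (Fin m) (Fin m) k)
    (Q : (a : A) → Submodule k (Fin (p a) → Matrix (Fin m) (Fin n) k)) (cap : A → ℕ) (ω : Module.Dual k (Matrix (Fin m) (Fin n) k))
    (g : Matrix (Fin n) (Fin n) k) (hg : IsUnit g.det) (hP : ∀ W ∈ P, W * g ∈ P) (hP' : ∀ W ∈ P, W * g⁻¹ ∈ P)
    (hQ : ∀ a, (Q a).map (stackMulRight (m := m) (p a) g hg).toLinearMap = Q a) :
    OmegaSolU P f Φ p σ M Q cap ω ↔ OmegaSolU P f Φ p σ M Q cap (dualMulRight ω g hg) := by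
  unfold OmegaSolU
  rw [matPruneSolU_iff_image_mul_right (fun s => omegaList P (f s) (Φ s) (dualMulRight ω g hg)) p σ M Q cap g hg]
  have hL : (fun s => (fun W : Matrix (Fin m) (Fin n) k => W * g) '' omegaList P (f s) (Φ s) (dualMulRight ω g hg)) =
      fun s => omegaList P (f s) (Φ s) ω := by
    funext s; exact image_mul_right_omegaList P g hg hP hP' (f s) (Φ s) ω
  have hQ' : (fun a => (Q a).map (stackMulRight (m := m) (p a) g hg).toLinearMap) = Q := funext hQ
  rw [hL, hQ']

/-- Projective rescaling with cone filters: `SOL(c • ω) ⇔ SOL(ω)` for `c ≠ 0`. -/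
theorem omegaSolU_smul_iff {ι A : Type*} {κ : A → Type*} (P : Submodule k (Matrix (Fin m) (Fin n) k))
    (f : ι → Module.Dual k (Matrix (Fin m) (Fin m) k)) (Φ : ι → (Matrix (Fin m) (Fin m) k → k) → Prop)
    (hΦ : ∀ s (c : k) (v : Matrix (Fin m) (Fin m) k → k), c ≠ 0 → (Φ s (c • v) ↔ Φ s v)) (p : A → ℕ)
    (σ : (a : A) → κ a → ι) (M : (a : A) → κ a → Fin (p a) → Matrix (Fin m) (Fin m) k)
    (Q : (a : A) → Submodule k (Fin (p a) → Matrix (Fin m) (Fin n) k)) (cap : A → ℕ) (ω : Module.Dual k (Matrix (Fin m) (Fin n) k))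
    {c : k} (hc : c ≠ 0) :
    OmegaSolU P f Φ p σ M Q cap (c • ω) ↔ OmegaSolU P f Φ p σ M Q cap ω := by
  have hlist : ∀ s, omegaList P (f s) (Φ s) (c • ω) = omegaList P (f s) (Φ s) ω := by
    intro s; ext W
    simp only [omegaList, Set.mem_setOf_eq, LinearMap.smul_apply]
    exact and_congr_right fun _ => hΦ s c (fun X => ω (X * W)) hc
  unfold OmegaSolU
  rw [show (fun s => omegaList P (f s) (Φ s) (c • ω)) = fun s => omegaList P (f s) (Φ s) ω from funext hlist]

/-- **One representative per `K`-orbit of `P(P^*)`** (union caps): `SOL(c • (ω ∘ (· g))) ⇔ SOL(ω)`. -/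
theorem omegaSolU_iff_smul_comp_mulRight {ι A : Type*} {κ : A → Type*} (P : Submodule k (Matrix (Fin m) (Fin n) k))
    (f : ι → Module.Dual k (Matrix (Fin m) (Fin m) k)) (Φ : ι → (Matrix (Fin m) (Fin m) k → k) → Prop)
    (hΦ : ∀ s (c : k) (v : Matrix (Fin m) (Fin m) k → k), c ≠ 0 → (Φ s (c • v) ↔ Φ s v)) (p : A → ℕ)
    (σ : (a : A) → κ a → ι) (M : (a : A) → κ a → Fin (p a) → Matrix (Fin m) (Fin m) k)
    (Q : (a : A) → Submodule k (Fin (p a) → Matrix (Fin m) (Fin n) k)) (cap : A → ℕ) (ω : Module.Dual k (Matrix (Fin m) (Fin n) k))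
    (g : Matrix (Fin n) (Fin n) k) (hg : IsUnit g.det) (hP : ∀ W ∈ P, W * g ∈ P) (hP' : ∀ W ∈ P, W * g⁻¹ ∈ P)
    (hQ : ∀ a, (Q a).map (stackMulRight (m := m) (p a) g hg).toLinearMap = Q a) {c : k} (hc : c ≠ 0) :
    OmegaSolU P f Φ p σ M Q cap (c • dualMulRight ω g hg) ↔ OmegaSolU P f Φ p σ M Q cap ω := by
  rw [omegaSolU_smul_iff P f Φ hΦ p σ M Q cap _ hc, ← omegaSolU_iff_comp_mulRight P f Φ p σ M Q cap ω g hg hP hP' hQ]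

/-- **Orderly in-branch symmetry with union caps.** -/
theorem omegaSolU_iff_restrict {ι A : Type*} {κ : A → Type*} [DecidableEq ι] (P : Submodule k (Matrix (Fin m) (Fin n) k))
    (f : ι → Module.Dual k (Matrix (Fin m) (Fin m) k)) (Φ : ι → (Matrix (Fin m) (Fin m) k → k) → Prop)
    (hΦ : ∀ s (c : k) (v : Matrix (Fin m) (Fin m) k → k), c ≠ 0 → (Φ s (c • v) ↔ Φ s v)) (p : A → ℕ)
    (σ : (a : A) → κ a → ι) (M : (a : A) → κ a → Fin (p a) → Matrix (Fin m) (Fin m) k)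
    (Q : (a : A) → Submodule k (Fin (p a) → Matrix (Fin m) (Fin n) k)) (cap : A → ℕ) (ω : Module.Dual k (Matrix (Fin m) (Fin n) k))
    (G : Set (Matrix (Fin n) (Fin n) k)) (hGdet : ∀ g ∈ G, IsUnit g.det)
    (hGP : ∀ g ∈ G, (∀ W ∈ P, W * g ∈ P) ∧ (∀ W ∈ P, W * g⁻¹ ∈ P))
    (hGω : ∀ g ∈ G, ∃ c : k, c ≠ 0 ∧ ∀ Y, ω (Y * g) = c * ω Y)
    (hGQ : ∀ g (hgG : g ∈ G) a, (Q a).map (stackMulRight (m := m) (p a) g (hGdet g hgG)).toLinearMap = Q a)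
    (s₁ : ι) (R : Set (Matrix (Fin m) (Fin n) k))
    (hR : ∀ v ∈ omegaList P (f s₁) (Φ s₁) ω, ∃ g ∈ G, ∃ c : k, c ≠ 0 ∧ c • (v * g) ∈ R) :
    OmegaSolU P f Φ p σ M Q cap ω ↔
      MatPruneSolU (Function.update (fun s => omegaList P (f s) (Φ s) ω) s₁ (omegaList P (f s₁) (Φ s₁) ω ∩ R)) p σ M Q cap := by
  unfold OmegaSolU
  refine matPruneSolU_iff_restrict (fun s => omegaList P (f s) (Φ s) ω) p σ M Q cap ?_ G hGdet ?_ hGQ s₁ R hR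
  · intro s c hc v hv
    exact omegaList_smul_mem P (f s) (Φ s) (hΦ s) ω c hc v hv
  · intro g hgG s
    obtain ⟨c, hc, hstab⟩ := hGω g hgG
    exact image_mul_right_omegaList_of_stab P g (hGdet g hgG) (hGP g hgG).1 (hGP g hgG).2 (f s) (Φ s) (hΦ s) ω c hc hstab

end OmegaListsU

end Summit.MatrixMultiplication.OmegaCensus.SmallFormats
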